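import Summits.BirchSwinnertonDyer.BirchSwinnertonDyer.Theses.ThetaPartnerAtTwo
import Summits.BirchSwinnertonDyer.BirchSwinnertonDyer.Theorems.ThetaPartnerAtTwoSignedTransportAtTwoRankZeroOfPrint
import HarnessLib

/-!
# Route `ThetaPartnerAtTwo`: the leaf `WAllNonCMAtTwoThetaHabitat` from the route's items WITH THE CRUX K1 `SignedTransportAtTwo`
# (stmt-BirchSwinnertonDyer-20333) REPLACED BY ITS ANALYTIC CHILD `MazurTateCongruenceAtTwoR` (stmt-21416) — a `closes`-shaped
# certificate (lead prover bsd-wall-tp2-p1 g8; `--supports stmt-BirchSwinnertonDyer-20333`; the pen decides whether to re-point `closes`)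

HONEST FRAMING. ONE THEOREM, hypotheses = the route's items BY NAME (all `def … : Prop`, several of them printed-but-unproved facts and
two research cruxes); conclusion = the route's registered leaf. Nothing is asserted; BSD is not proved by any of this.

`wAllNonCMAtTwoThetaHabitat_of_mazurTateCongruenceAtTwoR` has EXACTLY the binders of the route's deciding theorem `closes`
(rev PHASE T: `hmod hLrat hGZK hBF hPer2 hPubG hT hCMP hKato hStrP`) except that `hT : SignedTransportAtTwo` (K1, split, 7 leads,
research stubs at p = 2 as typed) is replaced by `hMT : MazurTateCongruenceAtTwoR` (K1's analytic child 21416). The body is the body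
of `closes` verbatim, with the single call of `hT` replaced by `SignedTransportAtTwo.signedTransportAtTwo_rankZero_of_print4 hG1 hG2 hG3 hG5
hGZK hMT … hAr …` (file `…RankZeroOfPrint`): at the habitat's partner `A` (which HAS `A.analyticRank = 0`) K1 follows from conjuncts
1, 2, 3, 5 of `PublishedInputsGreenbergControlAtTwo`, `RankEqAnalyticRankLeOne` and 21416.

So, kernel-exactly: on route TP2 the deciding chain no longer needs K1 as an item — `closes` can be re-pointed to this theorem's shape
(binder list `hmod hLrat hGZK hBF hPer2 hPubG hMT hCMP hKato hStrP`), leaving as research cruxes 21416 (analytic congruence at 2),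
K3 20308 (Kato at 2) and the PUB-discharged twins. The pen's call (D-0016: routes are the planner's pen); this file only certifies it.

References: [GreenbergVatsal2000] Thm. (1.4), §2; [Vatsal1999] Thm. (1.10); [EmertonPollackWeston2006] Thm. 1; [Kobayashi2003] Thm. 1.2,
Conjecture (p. 2); [BDKim2013] Thm. 1.1; [GreenbergLNM1716] §4.
-/

set_option autoImplicit false
-- D-0017: single-problem summit, so `Summit.BirchSwinnertonDyer.BirchSwinnertonDyer.…` repeats a namespace BY DESIGN.
set_option linter.dupNamespace false

noncomputable section

open scoped BigOperators Topology Classical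

namespace Summit.BirchSwinnertonDyer.BirchSwinnertonDyer.Theorems

open Literature Summit.BirchSwinnertonDyer.BirchSwinnertonDyer.Theses.ThetaPartnerAtTwo

/-- **The TP2 leaf with K1 replaced by its analytic child.** Same binders as the route's `closes` except `SignedTransportAtTwo` ↦
`MazurTateCongruenceAtTwoR`; same body except that K1 is supplied at the rank-0 partner by `signedTransportAtTwo_rankZero_of_print4`
from conjuncts 1, 2, 3, 5 of the Greenberg PUB support, GZK and 21416. Conditional on every binder (route items by name); closes nothing
by itself. [cite: GreenbergVatsal2000, Thm. (1.4) and §2] [cite: Vatsal1999, Thm. (1.10)] [cite: Kobayashi2003, Conjecture (p. 2)] -/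
theorem wAllNonCMAtTwoThetaHabitat_of_mazurTateCongruenceAtTwoR (hmod : ModularParametrizationSupply) (hLrat : EntireLFunctionRat)
    (hGZK : RankEqAnalyticRankLeOne) (hBF : BurungaleFlachCMRankZeroSupply)
    (hPer2 : RealPeriodPlusPeriodUnitAtTwoSupply) (hPubG : PublishedInputsGreenbergControlAtTwo)
    (hMT : MazurTateCongruenceAtTwoR) (hCMP : SignedMainConjectureCMTwoRankZeroOfPub)
    (hKato : SignedKatoDivisibilityUpToAtTwo) (hStrP : SignedControlAtTwoOfPub) :
    Summit.BirchSwinnertonDyer.WAllNonCMAtTwoThetaHabitat := by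
  -- as the route's `closes` (rev PHASE T): K2r0 and K4 BY NAME from the PUB binders via K2r0P / K4P; K3 a binder;
  -- NEW: K1 is NOT a binder — it is `signedTransportAtTwo_rankZero_of_print4` at (G1, G2, G3, G5, GZK, hMT), asked only at `hAr`
  obtain ⟨hG1, hG2, hG3, hG4, hG5⟩ := hPubG
  have hCM : SignedMainConjectureCMTwoRankZero := hCMP hBF hmod hLrat hGZK hPer2 hG1 hG2 hG3 hG4 hG5
  have hStr : SignedControlAtTwo := hStrP hG1 hG2 hG3 hG4 hG5
  intro W _ _ hcm hr hss ha hH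
  obtain ⟨A, iA, iA', hAcm, hAr, hAss, hAa, hcong⟩ := hH
  have hL : W.entireLFunction 1 ≠ 0 := (W.analyticRank_eq_zero_iff_holds (hLrat W)).mp hr
  -- the CM partner's analytic data: newform, period ratio, a Pollack pair at 2 (needs L(A,1) ≠ 0)
  have hLA : A.entireLFunction 1 ≠ 0 := (A.analyticRank_eq_zero_iff_holds (hLrat A)).mp hAr
  haveI : NeZero (A.conductorNorm ℤ) := ⟨(A.conductorNorm_pos_holds).ne'⟩
  obtain ⟨DmA⟩ := hmod A
  obtain ⟨ϖA, hϖApos, hϖAeq, hΩApos⟩ := DmA.exists_rat_mul_realPeriodRat_eq_plusPeriod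
  obtain ⟨LsA, LfA, hSPA, hPPA⟩ :=
    Summit.BirchSwinnertonDyer.BirchSwinnertonDyer.Theorems.exists_isPollackPair_two DmA.isNewformOf hAss.1 hAa hLA
  -- K2r0 (rev 13): the CM partner's signed structure + main conjecture at 2, asked ONLY at analytic rank 0
  obtain ⟨hmuA, hMCA⟩ := hCM A hAcm hAr hAss hAa
  have hMC : Summit.BirchSwinnertonDyer.Rank1Residual.Supersingular.KobayashiMainConjecture W 2 1 :=
    SignedTransportAtTwo.signedTransportAtTwo_rankZero_of_print4 hG1 hG2 hG3 hG5 hGZK hMT W A hcm hr hss ha hAcm hAr hAss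
      hAa hcong DmA.f DmA.isNewformOf ϖA hϖAeq LsA LfA hPPA hmuA hMCA (hKato W hcm hr hss ha)
  obtain ⟨h12, hKim⟩ := hStr W hcm hr hss ha
  exact Summit.BirchSwinnertonDyer.BirchSwinnertonDyer.Theorems.bsdp_two_of_kobayashiMainConjecture_two_of_frobeniusTrace_eq_zero
    W hmod hGZK hss.1 ha hL h12 hKim hMC


end Summit.BirchSwinnertonDyer.BirchSwinnertonDyer.Theorems

end
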